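import Mathlib
import HarnessLib
import HarnessLib.Audit
import Summits.KontsevichZagierPeriods.Statement
import Literature.NumberTheory.Transcendental.KZProductIdeal
import Literature.NumberTheory.Transcendental.KZRelationsLE
import Summits.KontsevichZagierPeriods.KontsevichZagierPeriods.Theorems.GaussManinCertificatesKZStokesBox
import HarnessLib.Audit.Status.Attr

/-!
Route: TwoRouteTransport

DORMANT since 2026-08-24T05:53:17Z (reconciler: no traction for 6.6 d (last activity item-proof-filed at 2026-08-17T15:33:48Z); parked, not closed — `ledger route dormant route-KontsevichZagierPeriods-TwoRouteTransport --off` to reactiv) — unstaffed, not closed; items shared with open routes are served there. `ledger route dormant <id> --off` reactivates.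

# Route TwoRouteTransport — Goursat cubic transported from its trivial anchor to x=1 gives Gauss
triplication; the KZ calculus is complete relative to the cubic endpoint pair

It suffices to show X = CubicEndpoint ∧ X3 — the two CRUX hypotheses of the crux-only deciding
theorem (rev 4, human ruling 2026-08-16) — where CubicEndpoint (crux, rank 4: the x = 1 fibre of
Goursat's cubic, Γ(1/9)²Γ(4/9) = (3/4)^{1/6}Γ(1/3)Γ(5/18)Γ(1/18) as a KZ-equivalence of two Euler
products on (0,1)²) is what the line's engine X1 ∧ X2 delivers through the routine support
TransportGlue; so the bet of the line is X1 ∧ X2 ∧ X3 (card two-route-hypergeometric-transport;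
conforming successor of the retired sector route CubicTransport). X1 (CubicTransportStable, the
card's engine H1/H-b made explicit):
Goursat's cubic (G3) 2F1(a,(2a+1)/6;1/2;x) = (1+x/3)^{-a} 2F1(a/3,(a+1)/3;1/2;x(9-x)^2/(3+x)^3) at a
= 1/6, in Euler-period form on (0,1)^2,
is STABLY KZ-equivalent (up to Beta-shaped spectators) at every real algebraic x ∈ [0,1], including
the singular fibre x = 1 where both
sides are Gauss sums and the identity reads Γ(1/9)²Γ(4/9) = (3/4)^{1/6}Γ(1/3)Γ(5/18)Γ(1/18) = Gauss
triplication at 1/9 modulo two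
Legendre duplications (card H3: two routes from the trivial anchor x = 0 to z = 1). X2
(BetaCancellation): Beta-shaped 1-dimensional
representations are non-zero-divisors modulo the moves. X3 (CompleteModCubicEndpoint, crux,
conjecture-grade, ranked last; rev 3 made the modulus SCALE-CLOSED, rev 4 re-pointed it from the
0312 pair to the cubic-endpoint pair so that `closes` needs cruxes only): the KZ calculus is
COMPLETE RELATIVE TO the ℚ̄_ℝ-line through the cubic-endpoint pair — every additive subgroup K of
formal representations that contains the move relations, is stable under every scaling endomorphism
[σ, f] ↦ [σ, a·f] (a real algebraic; `KZ.scale a`), and contains the differences [ρ] − [ρ'] of the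
two CubicEndpoint shapes, contains [r] − [r'] for any two rational representations (KZ §1.1 shape)
with equal value; in the ℚ̄_ℝ-vector space V = FormalRep ⧸ relations (divisible and torsion-free)
this reads ker(eval) ⊆ ℚ̄_ℝ·[d_E], d_E = the endpoint difference class: Conjecture 1 up to the
single direction [d_E] (implied by the summit, kernel-checked; the rev-2 wording — modulus the
cyclic group on the 0312 difference d, not scale-closed — was kernel-checked EQUIVALENT to the
summit by the refuter, halving scale(1/2)·d collapsing ℤ·d; a scale-closed modulus absorbs exactly
that collapse, and no product-type collapse is available without an open cancellation statement).
X1 ∧ X2 is the line's engine: it yields CubicEndpoint through TransportGlue and, with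
DuplicationFamily and the Γ-bookkeeping TriplicationGlue, the shared Gauss-triplication target
stmt-0312 as a by-product; X3 carries the summit's general difficulty
(Grothendieck-period-conjecture strength — the catalogued independence barriers bite exactly there
and the line has no lever on it beyond its precise statement); the route is full: `closes` takes
CubicEndpoint and X3 and concludes KontsevichZagierPeriods in two lines, and the Assembly item
records the whole line CubicTransportStable → BetaCancellation → TransportGlue →
CompleteModCubicEndpoint → KontsevichZagierPeriods.
Lean: `(∀ (r r' : Literature.NumberTheory.Transcendental.KZ.IntegralRep 2), r.domain = {x | ∀ i, x i
∈ Set.Ioo (0:ℝ) 1} → Set.EqOn r.integrand (fun x => (x 0) ^ (-(11:ℝ)/18) * (1 - x 0) ^ (-(8:ℝ)/9) *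
(x 1) ^ (-(7:ℝ)/9) * (1 - x 1) ^ (-(8:ℝ)/9)) r.domain → r'.domain = {x | ∀ i, x i ∈ Set.Ioo (0:ℝ) 1}
→ Set.EqOn r'.integrand (fun x => ((3:ℝ)/4) ^ ((1:ℝ)/6) * (x 0) ^ (-(7:ℝ)/9) * (1 - x 0) ^
(-(13:ℝ)/18) * (x 1) ^ (-(11:ℝ)/18) * (1 - x 1) ^ (-(17:ℝ)/18)) r'.domain →
Literature.NumberTheory.Transcendental.KZ.Equivalent r r') ∧ (∀ K : AddSubgroup
Literature.NumberTheory.Transcendental.KZ.FormalRep,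
Literature.NumberTheory.Transcendental.KZ.relations ≤ K → (∀ (a : ℝ) (ha : IsAlgebraic ℚ a) (c :
Literature.NumberTheory.Transcendental.KZ.FormalRep), c ∈ K →
Literature.NumberTheory.Transcendental.KZ.scale a ha c ∈ K) → (∀ (ρ ρ' :
Literature.NumberTheory.Transcendental.KZ.IntegralRep 2), ρ.domain = {x | ∀ i, x i ∈ Set.Ioo (0:ℝ)
1} → Set.EqOn ρ.integrand (fun x => (x 0) ^ (-(11:ℝ)/18) * (1 - x 0) ^ (-(8:ℝ)/9) * (x 1) ^
(-(7:ℝ)/9) * (1 - x 1) ^ (-(8:ℝ)/9)) ρ.domain → ρ'.domain = {x | ∀ i, x i ∈ Set.Ioo (0:ℝ) 1} →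
Set.EqOn ρ'.integrand (fun x => ((3:ℝ)/4) ^ ((1:ℝ)/6) * (x 0) ^ (-(7:ℝ)/9) * (1 - x 0) ^
(-(13:ℝ)/18) * (x 1) ^ (-(11:ℝ)/18) * (1 - x 1) ^ (-(17:ℝ)/18)) ρ'.domain →
Literature.NumberTheory.Transcendental.KZ.of ρ - Literature.NumberTheory.Transcendental.KZ.of ρ' ∈
K) → ∀ ⦃n m : ℕ⦄ (r : Literature.NumberTheory.Transcendental.KZ.IntegralRep n) (r' :
Literature.NumberTheory.Transcendental.KZ.IntegralRep m), r.IsRational → r'.IsRational → r.value =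
r'.value → Literature.NumberTheory.Transcendental.KZ.of r -
Literature.NumberTheory.Transcendental.KZ.of r' ∈ K)`

## Assembly
Two lines of logic (glue.lean `theorem closes`, crux-only, native-certified, axioms
propext/Classical.choice/Quot.sound): CompleteModCubicEndpoint instantiated at K := relations
(`le_rfl`; relations is scale-closed by `KZ.scale_mem_relations`), the endpoint differences supplied
by the crux CubicEndpoint, puts [r] − [r'] of any two rational value-equal representations in
relations, which is KZ.Equivalent r r' by definition. Around it, as items: TransportGlue turns
CubicTransportStable ∧ BetaCancellation into CubicEndpoint (the Assembly item is this four-step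
chain, inhabited in Sketch.lean); TriplicationGlue adds DuplicationFamily and gives
TriplicationAccessible (target, stmt-0312, by-product); KZStokesBox is the engine's tool. None of
these supports is a hypothesis of `closes`.

Rationale: WHY THIS LINE. Transformation theory is the ALGEBRAIC part of Γ-lore (φ rational, λ algebraic):
Goursat's cubic list (Goursat1881; Vidunas2009 §4,
covering (1/2,1/3,p) ←3– (1/2,p,2p), third formula, read this session on arXiv:math/0408269 p.10)
contains (G3), whose covering
φ(x) = x(9−x)²/(3+x)³ maps [0,1] monotonically onto [0,1] with regular prefactor, so that at a = 1/6
both sides are Gauss-summable at the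
common endpoint x = φ(x) = 1 (margins c−a−b = 1/9, 1/18) while at the anchor x = 0 both sides are
the SAME product of two Beta integrals
up to a coordinate swap; the only non-algebraic step of the textbook proof (AndrewsAskeyRoy1999 Ch.
3: "both sides solve one ODE,
compare at 0, let x → 1") becomes flat transport of the gauged Wronskian along the real algebraic
arc [0,1] by one Newton–Leibniz move in
x plus creative-telescoping certificates discharged fibrewise (BostanLairezSalvy2013, Lairez2015;
AomotoKita2011 §3.5–3.6: Wronskians of
Euler integrals are Γ-products, which is why the linear identity arrives multiplied by a Beta
spectator and X2 is needed). Imported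
areas: classical hypergeometric transformation/summation theory, D-module certificates, twisted de
Rham theory; the endpoint identity
plus Legendre duplication at 1/18 and 5/18 is LITERALLY the Gauss-triplication pair stmt-0312
(re-derived symbolically and checked to
1e-15 this session). What no other line on 0312 does: FermatIsogeny reduces 0312 to a
Koblitz–Rohrlich isogeny (a ℚ̄-LINEAR Beta
relation), MultivaluedCoV/TerasomaCovering to sheets of an Aoki surface cycle, MellinCoarea to a
coarea fibre transfer, WZCosetWall to
contiguity cosets, ExpConservative/Neg to the Γ detour; the sibling transport engines in the tree
(GaussManinCertificates.
LegendreModulusPropagation, GammaCornerAnomaly.LogWronskianTransport) stay inside the Legendre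
pencil between REGULAR algebraic fibres —
here the transport crosses an algebraic degree-3 pull-back and ends ON the singular fibre, which is
what converts a transformation into
a multiplication-formula instance. Versus the retired gen-1 route CubicTransport (same instance
items): the deciding theorem reaches
the Statement through the relative-completeness crux CompleteModTriplication (rev 2, D-0018 NOTE 3:
claimed as the route's own
conjecture-grade crux in universal-property form, no longer a support; rev 3: its modulus made
SCALE-CLOSED after the refuter showed the cyclic-modulus wording equivalent to the summit; rev 4:
re-pointed at the cubic-endpoint pair, CompleteModCubicEndpoint, so that `closes` assumes cruxes
only), and the fibrewise Stokes tool is registered as the shared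
support KZStokesBox.

RANKED CRUXES. #0 TriplicationAccessible (target) — the Gauss-triplication pair
stmt-KontsevichZagierPeriods-0312 verbatim (terminal node of the sector; shared with Neg,
FermatIsogeny, MultivaluedCoV, KatzTower, CyclesAsDomains): [(0,1)²,
x^{-8/9}(1−x)^{-5/9}y^{-4/9}(1−y)^{-2/9}] (value B(1/9,4/9)B(5/9,7/9)) and [disc of radius 2,
constant 3^{7/6}/2] (value 2π·3^{7/6} = 22.6371282948…) are KZ-equivalent. (why it might fail: it is
the negation of Neg's rank-2 bet 0311: the identity is known only through Γ (an exponential period)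
or an absolute-Hodge class on the degree-9 Fermat surface; no rules-proof is recorded.)
[Deligne1982HodgeCycles, Waldschmidt2006, KontsevichZagier2001]
#2 CubicTransportStable (crux) — for every real algebraic x ∈ [0,1] the two sides of (G3) at a = 1/6
in period form — A(x) on (0,1)² with integrand
u^{-11/18}(1−u)^{-8/9}·t^{-7/9}(1−t)^{-13/18}(1−xt)^{-1/6} (=
B(7/18,1/9)·B(2/9,5/18)·2F1(1/6,2/9;1/2;x)) and B(x) with integrand
(1+x/3)^{-1/6}·u^{-7/9}(1−u)^{-13/18}·s^{-11/18}(1−s)^{-8/9}(1−φ(x)s)^{-1/18}, φ(x) = x(9−x)²/(3+x)³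
— are STABLY KZ-equivalent: some finite product of Beta-shape representations multiplies [A(x)] −
[B(x)] into relations (card H1/H-b; mechanism: trivial anchor A(0) ~ B(0) by the coordinate swap,
one Newton–Leibniz move in x with the integrand family as primitive, telescoper certificates L_x f =
∂_t(C·f) for both kernels under L = x(1−x)∂² + (1/2 − (25/18)x)∂ − 1/27 turning ∂_x of the gauged
Wronskian p·(E v′ − E′ v), p = x^{1/2}(1−x)^{8/9}, into total t-derivatives killed by KZStokesBox;
partner v = x^{1/2}·Euler family of 2F1(2/3,13/18;3/2;x) on (0,1), the exponent-1/9 solution at x =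
1; spectators β₃ = B(5/6,2/3), β_v = B(5/18,5/6)). [deps: KZStokesBox] [difficulty: XL] (why it
might fail: certificate boundary terms C·f must vanish on the CLOSED faces t = 0,1 for exponents
(2/9,5/18),(7/18,1/9), and the second x-derivative kernels must stay absolutely integrable on the
band up to x = 1 where the margin is exactly c−a−b = 1/9 resp. 1/18; one bad corner breaks the
chain.) [BostanLairezSalvy2013, Lairez2015, AomotoKita2011, Vidunas2009, KontsevichZagier2001]
#3 BetaCancellation (crux) — every 1-dimensional representation of Beta shape (domain (0,1),
integrand C·u^p(1−u)^q with C ≠ 0 real and p, q > −1 rational) is a non-zero-divisor modulo the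
moves: [β]·c ∈ relations ⇒ c ∈ relations. It follows from the kernel form of the summit (eval is
multiplicative, KZProductIdeal eval_mul', and B(p+1,q+1) ≠ 0), generalises the flavour of
KZ.PiCancellation (stmt-0540, KatzTower.PiCancellation), and is what upgrades stable transport to
the clean identities (used twice: in TransportGlue and in TriplicationGlue). [difficulty:
open-problem] (why it might fail: kernel-conjecture strength: a proof needs structure of FormalRep ⧸
relations nobody has (the effective-vs-localised seam of PiCancellation 0540, HuberWustholz2022 App.
A.4; no division by integers is a rule); a refutation (a Beta zero-divisor) refutes the summit
itself.) [HuberWustholz2022, KontsevichZagier2001, AomotoKita2011, Ayoub2015]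
#4 CubicEndpoint (crux; hypothesis of `closes` from rev 4) — the x = 1 specialisation of (G3) at a =
1/6 in Euler-period form, as a KZ-equivalence of two 2-dimensional representations on (0,1)²:
integrand s^{-11/18}(1−s)^{-8/9}·t^{-7/9}(1−t)^{-8/9} (value B(7/18,1/9)·B(2/9,1/9)) versus
(3/4)^{1/6}·s^{-7/9}(1−s)^{-13/18}·t^{-11/18}(1−t)^{-17/18} (value
(3/4)^{1/6}·B(2/9,5/18)·B(7/18,1/18)); both 143.43224118…; in Γ-form Γ(1/9)²Γ(4/9) =
(3/4)^{1/6}Γ(1/3)Γ(5/18)Γ(1/18) (card H3 made explicit; the bare endpoint bet, reachable by other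
engines too). [deps: CubicTransportStable, BetaCancellation] [difficulty: open-problem] (why it
might fail: equivalent to 0312 modulo accessible duplication, so it inherits Neg's bet 0311;
transport reaches it only up to Beta spectators (needs BetaCancellation) and must END on the
singular fibre x = 1, where Abel's limit is not a move.) [Vidunas2009, Goursat1881,
AndrewsAskeyRoy1999, Deligne1982HodgeCycles]
#5 CompleteModCubicEndpoint (crux, conjecture-grade; served after the engine cruxes; rev 4) —
relative completeness of the KZ calculus modulo the ℚ̄_ℝ-LINE through the cubic-endpoint class,
universal-property form: for every additive subgroup K of formal representations with relations ≤ K,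
K stable under every scaling endomorphism KZ.scale a ([σ, f] ↦ [σ, a·f], a real algebraic) and K ∋
[ρ] − [ρ'] for all representations ρ, ρ' of the two CubicEndpoint shapes (both of value
143.432241180858…, re-checked here to 6e-16), any two RATIONAL representations r, r' (KZ §1.1 shape)
with equal value have [r] − [r'] ∈ K. Dictionary: V = FormalRep ⧸ relations is a ℚ̄_ℝ-vector space
(KZ.scale; divisible, torsion-free: tree MultiplicationAccessible/Negative/Core), eval ℚ̄_ℝ-linear,
every class in ker(eval) is a rational equal-value difference (exists_integralRep_sub_holds,
exists_isRational_equivalent_holds), and all endpoint differences are one class [d_E]; so X3 ⟺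
ker(eval) ⊆ ℚ̄_ℝ·[d_E] ⟺ summit ∨ (eval d_E = 0 ∧ ker eval = ℚ̄_ℝ·[d_E]): Conjecture 1 up to the ONE
direction [d_E]; X3 ∧ CubicEndpoint ([d_E] = 0) is the summit (`closes`, two lines) and summit ⇒ X3
(`completeModCubicEndpoint_of_summit`, Sketch.lean rc 0), hence value-consistent and refutable only
together with the summit. History: the rev-2 wording (modulus relations ⊔ ℤ·d on the 0312 difference
d, not scale-closed) was kernel-checked ↔ summit by the refuter (note 2026-08-16T03:32Z on
stmt-14101, evidence Equiv.lean): the half scale(1/2)·d is itself a rational equal-value difference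
mod relations, so (1−2k)·d ∈ relations, d ∈ relations by torsion-freeness, X3(K₀) = summit verbatim
and X1, X2 idle; rev 3 (stmt-14582) added scale-closure, which absorbs exactly that collapse; rev 4
moved the modulus to the endpoint pair because `closes` through 0312 needs the unproved supports
TriplicationGlue/DuplicationFamily as hypotheses (crux-only ruling 2026-08-16). No further cheap
collapse found (this seat, by hand): if eval d_E = 0 the alternative 'ker eval = ℚ̄_ℝ·[d_E] ≠ 0' is
an abstract possibility for V — a ℚ̄_ℝ-valued character χ of the KZ algebra separating the two
endpoint products (V ≅ ℚ̄_ℝ × eval(V) via the idempotent d_E/χ(d_E), or a square-zero extension if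
χ(d_E) = 0; Artin–Lang supplies retractions finitely) — excluded neither by the product structure
nor by BetaCancellation (single Beta generators regular); excluding it IS proving CubicEndpoint
accessible, or an open 0540-type cancellation for non-generators. It is the complement of the sector
in the sense of D-0018 NOTE 3: X1 ∧ X2 settle the sector node CubicEndpoint (and 0312 behind it), X3
is the general completeness statement every full route on this summit carries in some form (the
complement cruxes of MotivatedMoves / GammaCornerAnomaly / FermatIsogeny; by the refuter's general
pattern their moduli must be scale-closed too); relative versions in print: Ayoub2015
(relative/geometric form), HuberMullerStach2017 Ch. 13 (formal period algebra), HuberWustholz2022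
(1-periods, where completeness IS a theorem). [difficulty: XL, conjecture-grade] (why it might fail:
GPC-strength: ker(eval) ⊆ the ℚ̄-line through the endpoint class — Conjecture 1 for all rational
pairs up to one direction (with CubicEndpoint = the summit; odd-zeta / 2πi-log independence follow);
only the halving collapse is excluded, a product-type collapse would misstate it.)
[KontsevichZagier2001, Ayoub2015, HuberMullerStach2017, HuberWustholz2022]
#9 DuplicationFamily (support) — Legendre duplication in Beta form for every rational a > 0 (shared
stmt-3727): [(0,1), (u(1−u))^{a−1}] ~ [(0,1), 2^{1−2a}·u^{-1/2}(1−u)^{a−1}] (three moves: split at u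
= 1/2, u ↦ 1−u, t = 4u(1−u)); stmt-0118 is a = 1/3; TriplicationGlue uses a = 1/18 and a = 5/18.
[difficulty: provable-now] [AndrewsAskeyRoy1999, KontsevichZagier2001]
#9 KZStokesBox (support) — KZ-Stokes on an open box (shared stmt-3015,
GaussManinCertificates.KZStokesBox; also KatzTower): a ℚ-semialgebraic H on the closed box,
continuous in the last variable on closed fibres, vanishing on the two last-coordinate faces, with
∂_last H = integrand inside ⟹ [r] ∈ relations (one newtonLeibnizRel over the base box + two null
faces). It is the fibrewise discharge tool for the telescoper certificates of CubicTransportStable.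
[difficulty: provable-now] [KontsevichZagier2001, Lairez2015]
#9 TransportGlue (support) — glue of the foreseen split of CubicEndpoint: CubicTransportStable →
BetaCancellation → CubicEndpoint (instantiate x = 1: φ(1) = 1, (1+1/3)^{-1/6} = (3/4)^{1/6},
(1−t)^{-13/18}(1−t)^{-1/6} = (1−t)^{-8/9} and (1−t)^{-8/9}(1−t)^{-1/18} = (1−t)^{-17/18} pointwise
on (0,1), so the Set.EqOn hypotheses transfer; then peel the Beta spectators off the foldr by
induction on the list with BetaCancellation). [difficulty: provable-now] [KontsevichZagier2001]
#9 TriplicationGlue (support) — Γ-bookkeeping inside the product calculus (KZProductIdeal, all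
PROVED: relations is a two-sided ideal, products commute modulo relations, reindexing is a change of
variables): CubicEndpoint → BetaCancellation → DuplicationFamily → TriplicationAccessible (the
DuplicationFamily hypothesis is written out verbatim in the Lean term so that the decl does not
depend on rendering order; it is the same Prop as item DuplicationFamily). Multiply the 0312 product
T = B(1/9,4/9)·B(5/9,7/9) by a Beta spectator X; regroup with Beta symmetry (u ↦ 1−u), Dirichlet
associativity B(x,y)B(x+y,z) ~ B(y,z)B(y+z,x) (both ~ the Dirichlet simplex by (u,v) ↦ (u,(1−u)v)),
translation (Newton–Leibniz with monomial primitive) and B(x,1) ~ 1/x; apply CubicEndpoint, then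
DuplicationFamily at a = 1/18 and a = 5/18 (symbolically: endpoint × dup(1/18) × dup(5/18) ⟺
Γ(1/9)Γ(4/9)Γ(7/9) = 2π·3^{1/6}Γ(1/3), re-derived this session); the Γ-content becomes
2·3^{7/6}·B(1/2,1/2)·X; cancel X (BetaCancellation); [B(1/2,1/2)] ~ [unit disc, 1] (u = (1+v)/2,
KZ's own 2∫√(1−v²) = ∫1/√(1−v²) step, band |w| ≤ √(1−v²)) and the scaling (v,w) ↦ (2v,2w) give the
radius-2 disc with constant 3^{7/6}/2. [difficulty: L] [KontsevichZagier2001, AndrewsAskeyRoy1999]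

TWO-LAYER PLAN. Foreseen glued splits (none filed now): CubicTransportStable ⇐
InteriorWronskianTransport (all algebraic x < 1, spectator β₃) →
EndpointProbe (the band reaches x = 1 with the exponent-1/9 partner, spectator β_v) →
CubicTransportStable; BetaCancellation ⇐
PiCancellation (stmt-0540, shared with KatzTower/AyoubSpecialisation) → BetaComplement (β·β′ ~
q·[π]^k from the twisted period relations,
AomotoKita2011 Example 3.4) → BetaCancellation; CubicEndpoint ⇐ TransportGlue (already typed). k ≤ 3
each, depth 1. After CubicEndpoint
closes: the whole (G3) family a ∈ ℚ ∩ (−1/2,1/4) (endpoint(a) × duplication at 2v−1/6 and v+1/6 ⟺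
triplication at v = 1/6 − a/3,
v ∈ (1/12,1/3), verified symbolically and numerically here) as ONE family crux, extended to all
ninths by WZCosetWall.TriplicationThirdShift.

KILL CRITERIA. Refutation of TriplicationAccessible or CubicEndpoint by an additive invariant of
FormalRep killing the four move sets (shape Neg 0313)
is Neg's win and closes this route `refuted:<Decl>` (and, values being equal, refutes the summit —
report to the operator); the same
holds for BetaCancellation, CubicTransportStable and CompleteModCubicEndpoint, all implied by the
summit (for X3 the implication summit ⇒ X3 is kernel-checked, so X3 can only die together with the
summit). X3 dies AS STATED (again) if a refuter kernel-checks `CompleteModCubicEndpoint →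
KontsevichZagierPeriods` (a collapse of the scale-closed modulus other than halving): then no
faithful complement strictly between the sector and the summit is typed on this line; close the
route `refuted` (not-a-thesis) and bank X1 ∧ X2 + glue as the sector card's engine. The MECHANISM
dies earlier and
cheaper: if the refuter's certificate job shows no rational telescoper certificate for the
φ-pulled-back kernel, or a certificate pole
inside (0,1) × [0,1], or a divergent boundary term at x = 1 that no domain split repairs — then
CubicTransportStable survives only as a
bare bet, the line has no engine, close `exhausted` with the census. A non-integrable corner at x =
1 ONLY ⇒ restate on Ico and file the
endpoint probe as its own crux (pivot, not kill). If stmt-0312 is proved first by FermatIsogeny /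
MultivaluedCoV / MellinCoarea /
KatzTower, keep only the H1 value (stable transport of a transformation family): go dormant or close
`superseded`.

NOT DECOMPOSED YET. The certificates themselves (explicit telescopers C(t,x) for
t^{-7/9}(1−t)^{-13/18}(1−xt)^{-1/6} under L = x(1−x)∂² + (1/2 − (25/18)x)∂ −
1/27 and for the pulled-back kernel; a CAS job) and the integrability / face-vanishing lemmas —
layer-2 children of CubicTransportStable;
rpow-semialgebraicity and integrability constructors for Beta/Euler representations (prover lemmas
via --supports, shared need with
FermatIsogeny/MotivatedMoves provers); the BetaComplement identities reducing BetaCancellation to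
PiCancellation; whether a spectator-free
Beta-product chain CubicEndpoint → 0312 exists (monoid versus group of Beta symbols — if yes
BetaCancellation leaves TriplicationGlue); the
(G3) family for general a and Vidunas2009's degree-4/6 Goursat coverings (1/2,1/3,p) ←4– (1/3,p,3p)
(same engine, other Γ-instances); the
card's literal second route (AndrewsAskeyRoy1999 (3.1.16)–(3.1.17) against the second cubic at x =
1/9) — recorded only.

CHEAPEST FALSIFIER. Done while planning (folder check_g3.py, stdlib only): (i) (G3) against the 2F1
series for a ∈ {0.1, 1/6, 0.2, −0.3, 0.24}, x ∈
{0.1,…,0.8}: max relative defect 5.6e-15 (φ monotone [0,1] → [0,1], no branch problem); (ii) Gauss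
sums at x = 1 agree on both sides for
a ∈ {0.05, 0.1, 1/6, 0.2, −0.3} (a = 1/6: 1.7382432619 both); endpoint products 143.43224118085
both; (iii) Γ-bookkeeping: endpoint(a) +
duplication(2v−1/6) + duplication(v+1/6) ⟺ triplication at v = 1/6 − a/3 symbolically, 0312 value
22.63712829483 = 2π·3^{7/6} three ways;
(iv) formula (G3) confirmed verbatim in Vidunas2009 §4 (arXiv:math/0408269 p.10, third Goursat
cubic). Still to run (refuter, a 10-line
CAS job off-box): the telescoper certificates for both kernels; a pole inside (0,1) × [0,1] or a
divergent boundary term at x = 1 kills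
the engine (not the statements).

NUMBERS. (G3): 2F1(a,(2a+1)/6;1/2;x) = (1+x/3)^{-a}·2F1(a/3,(a+1)/3;1/2;x(9−x)²/(3+x)³) (Vidunas2009
§4; Goursat1881); a = 1/6: (a,b,c) =
(1/6,2/9,1/2), (a′,b′,c′) = (1/18,7/18,1/2); c−a−b = 1/9, c′−a′−b′ = 1/18; admissible family range a
∈ (−1/2,1/4) (all six endpoint
exponents > −1 exactly there); φ′ ∝ 27(9−x)(1−x)/(3+x)⁴, φ(1) = 1 (double); λ(1) = (3/4)^{1/6};
gauge p(x) = x^{1/2}(1−x)^{8/9};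
spectators β₃ = B(5/6,2/3), β_v = B(5/18,5/6); endpoint product value 143.43224118085; 0312 value
22.63712829483 = 2π·3^{7/6};
triplication family normal form B(v,v+1/3)·B(2v+1/3,v+2/3) = 2π·3^{1/2−3v}/(3v) (v = 1/9 is 0312's
cube integrand exactly). Items at
open: 10 (1 target, 3 cruxes, 5 supports, 1 assembly); after revs 2–4: 10 active (1 target, 4
cruxes, 4 supports, 1 assembly); deciding theorem: 6 hypotheses up to rev 3, 2 from rev 4
(CubicEndpoint, X3 — cruxes only); cone 35 project constants / 0 unproved after rev 3 (+ KZ.scale,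
IntegralRep.constMul).

DEFINITION REQUESTS. None. All statements are over
Literature.NumberTheory.Transcendental.KZ.{IntegralRep, Equivalent, FormalRep, of, relations,
IsRational, value, scale} and the ring structure of KZProduct/KZProductIdeal; imports
Literature.NumberTheory.Transcendental.KZProductIdeal (kept: carries the `_holds` discharges of
KZProduct's three named facts) and, from rev 3, Literature.NumberTheory.Transcendental.KZRelationsLE
(`KZ.scale`, `IntegralRep.constMul`, `scale_mem_relations`, all proved; adds KZRelationsLE,
KZSemialgebraicComplex, KZCalculusProofs to the module closure: no closed named Prop, no conjecture,
no sorry). CONE (route-repair gen 1, 2026-08-15; needs-fact none): the 4 module-cone census entries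
KZPeriodConjecture′ / KZKernelConjecture (open forms of the summit: the Statement baseline) and
KZ.PiCancellation / KZ.PiLocalKernel (KZProduct `@[conjecture]` items 0540/0541 of
AyoubSpecialisation, riding with the `Mul` instance X1/X2 use) are reached by no constant of this
route. REV 2 (route-repair badge, 2026-08-16; hold partial-claim 02:41Z): rev-1 support
TriplicationComplete (auto-crux 02:19Z) replaced by the claimed crux CompleteModTriplication (rank
5), Assembly restated, `closes` re-certified. REV 3 + REV 4 (route-repair rrefute, 2026-08-16;
refuter note 03:32Z on stmt-14101, class misstated = restates the target, evidence Equiv.lean /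
Repair.lean / W.lean): rev 3 restated X3 with the scale-closed modulus (the refuter's alternative
C″, equivalent to their C′ = free algebraic constant in the shapes: same smallest modulus) and
re-proved the six-hypothesis `closes`; the gate then flagged glue.non-crux-hypothesis
(TransportGlue, DuplicationFamily, TriplicationGlue are supports; ruling 2026-08-16), so rev 4
re-points X3 at the cubic-endpoint pair (CompleteModCubicEndpoint, new decl) and certifies the
two-hypothesis crux-only `closes`, restating the Assembly item as the four-step line; Sketch.lean
(folder) rc 0 on the farm for every decl named here; the other 8 items unchanged.

Novelty: Searches (2026-08-15, this seat): `lit search --hybrid "cubic transformation hypergeometric function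
Gauss summation gamma multiplication
formula"` (12 docs: AndrewsAskeyRoy1999 pp.100–101, Fuselier–Long–Ramakrishna–Swisher–Tu 2022,
Berndt's Ramanujan Notebooks, Gasper–Rahman —
none phrases transformations as rule-chains); `lit galaxy search "cubic transformation of the
hypergeometric function" --star all` (4:
Slater, NIST Handbook §15.8, Whittaker–Watson, Magnus legacy volume; pdf/crabby 0); `lit read
arxiv:math/0408269 --grep cubic` (Vidunas2009
§4 p.10: the formula, no Γ-evaluation drawn from it); zbMATH/remote cascade unavailable this hour
(searchd rc 75, recorded); `ledger
negatives --problem KontsevichZagierPeriods` (1 entry, KinematicFormulas convexity, unrelated); all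
80 Theses headers of the sub read for
transport/transformation engines. Inherited from the gen-1 seat (same card, 2026-08-15): AAR
pp.101–106,140 read (Thm 3.1.1, Cor 3.1.2, Thm
3.1.3 + Remark = duplication from the quadratic route IN PRINT, (3.1.15)–(3.1.18), Ex. 38),
AomotoKita2011 Thm 3.5/§3.5.9/Ex. 3.4–3.5, zbMATH
"multiplication formula gamma function" (15: Stolarsky 1991, Vidunas2005 — none via
transformations), crossref "cubic transformation
hypergeometric gamma" (12, none), galaxy "triplication formula" (17, cubic theta only), lit
frontier/bridges (nothing on transformations).
Nearest prior art found: AndrewsAskeyRoy1999 Cor. 3.1.2 + Remark after (3.1.8) (quadratic route to 1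
+ Gauss sum = Legend  [refs: math/0408269, arxiv:math/0408269, AndrewsAskeyRoy1999, Vidunas2009, AomotoKita2011, Vidunas2005, Lairez2015, BostanLairezSalvy2013]

Barriers (technique_class: hypergeometric-transformation flat-transport cancellation): - technique_class: hypergeometric-transformation flat-transport cancellation
- Literature.Barriers.KontsevichZagierPeriods.noSemialgebraicPrimitive_inv_sub_two: evaded — no
primitive of an integrand in its own variable is ever taken; the x-direction primitive is the
algebraic integrand family itself and the t-direction primitives are certificate·kernel (rational ×
algebraic); the transcendental primitive ∫dx/p (incomplete Beta, non-algebraic by Chebyshev) is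
exactly what the Wronskian formulation avoids — at the price of the Beta spectator (crux
BetaCancellation).
- Literature.Barriers.KontsevichZagierPeriods.kzConjecture_implies_oddZetaAlgIndep: it does not
evade it at the crux CompleteModCubicEndpoint (X3, conjecture-grade, rank 5): X3 together with the
sector identity CubicEndpoint is the summit, so every consequence of the summit — here algebraic
independence of odd zeta values forced by the rules — is a consequence of X3 ∧ CubicEndpoint, and
the line has no lever on X3; the bet of the LINE is confined to the engine cruxes
CubicTransportStable, BetaCancellation, CubicEndpoint, which are statements about explicit
hypergeometric periods of CM/Fermat type with no algebraic-independence consequence.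
- Literature.Barriers.KontsevichZagierPeriods.kzConjecture_implies_twoPiI_log_algIndep: same split —
engaged by X3 only (X3 ∧ CubicEndpoint = summit); the engine cruxes produce no constant beyond π
(the disc) and Beta values at ninths.
- Literature.Barriers.KontsevichZagierPeriods

History (route lifecycle, newest last):
- 2026-08-16T02:19:05Z · AUTO-CRUX: 1 conjecture-grade item(s) promoted to crux (TriplicationComplete) — refuter vetting / tiering apply (operator:999:1362873)
- 2026-08-16T02:59:53Z · rev 2: restated Assembly (stmt-KontsevichZagierPeriods-12077) — route-repair(badge) gen1 rev2: hold partial-claim (D-0018 NOTE 3) cleared by CLAIMING the relative-completeness complement: support/auto-crux TriplicationComple (planner-rbadge-KontsevichZagierPeriods-TwoRout-17a6e912-0)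
- 2026-08-16T02:59:53Z · rev 2: dropped TriplicationComplete — route-repair(badge) gen1 rev2: hold partial-claim (D-0018 NOTE 3) cleared by CLAIMING the relative-completeness complement: support/auto-crux TriplicationComple (planner-rbadge-KontsevichZagierPeriods-TwoRout-17a6e912-0)
- 2026-08-16T03:59:00Z · rev 6: restated CompleteModTriplication (stmt-KontsevichZagierPeriods-14101) — rev 3 route-repair(rrefute) gen1: restated CompleteModTriplication (stmt-14101, refuter class misstated = restates the target) with a SCALE-CLOSED modulus (refu (planner-rrefute-KontsevichZagierPeriods-TwoRou-c2c3b362-0)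
- 2026-08-16T04:11:06Z · rev 7: restated CompleteModTriplication (stmt-KontsevichZagierPeriods-14582), Assembly (stmt-KontsevichZagierPeriods-14100) — rev 4 route-repair(rrefute) gen1, follow-up to rev 3: the gate flagged glue.non-crux-hypothesis (closes assumed supports TransportGlue/DuplicationFamily/Triplic (planner-rrefute-KontsevichZagierPeriods-TwoRou-c2c3b362-0)
- 2026-08-24T05:53:17Z · DORMANT — reconciler: no traction for 6.6 d (last activity item-proof-filed at 2026-08-17T15:33:48Z); parked, not closed — `ledger route dormant route-KontsevichZagierPer (operator:999:3491828)

sub-problem: KontsevichZagierPeriods · status: dormant · opened planner-plancard-KontsevichZagierPeriods-Kont-835ffb7a-g2-0 2026-08-15T18:48:39Z · rev 8 · ledger route-KontsevichZagierPeriods-TwoRouteTransport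
GENERATED by the gate from the ledger (D-0016/17). Provers cite these decls: `theorem foo : Summit.KontsevichZagierPeriods.KontsevichZagierPeriods.Theses.TwoRouteTransport.<Decl> := …` in Summits/KontsevichZagierPeriods/KontsevichZagierPeriods/Theorems/<Name>.lean.
-/

namespace Summit.KontsevichZagierPeriods.KontsevichZagierPeriods.Theses.TwoRouteTransport

open scoped BigOperators Topology Manifold Classical MeasureTheory ProbabilityTheory Matrix InnerProductSpace ComplexConjugate ContinuousMap
open Filter Set Function TopologicalSpace MeasureTheory

attribute [summit_statement] _root_.KontsevichZagierPeriods

open Literature Periods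

/-- item stmt-KontsevichZagierPeriods-0312 · target · rank 0 · open · by planner
why it might fail: it is the negation of Neg's rank-2 bet 0311: the identity is known only through Γ (an exponential period) or an absolute-Hodge class on the degree-9 Fermat surface; no rules-proof is recorded.
sources: Deligne1982HodgeCycles, Waldschmidt2006, KontsevichZagier2001
Positive form of #2. A proof must avoid Γ: candidate strategy = realise the degree-9 Fermat-curve
correspondence behind the identity as semialgebraic changes of variables between (blow-ups of)
(0,1)² pieces plus Newton–Leibniz with algebraic primitives (Rohrlich/Deligne distribution relations
are induced by the maps x ↦ x³ on Fermat curves — algebraic, finite ⇒ CoV on injectivity cells). If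
found, pressure point (b) of route Neg dies at its first instance. [elaborates: yes:
_survey/SketchB.lean; sources: Deligne1982HodgeCycles, KontsevichZagier2001] -/
@[route_item "route-KontsevichZagierPeriods-TwoRouteTransport"]
def TriplicationAccessible : Prop :=
  ∀ (r r' : Literature.NumberTheory.Transcendental.KZ.IntegralRep 2), r.domain = {x | ∀ i, x i ∈ Set.Ioo (0:ℝ) 1} → Set.EqOn r.integrand (fun x => (x 0) ^ (-(8:ℝ)/9) * (1 - x 0) ^ (-(5:ℝ)/9) * (x 1) ^ (-(4:ℝ)/9) * (1 - x 1) ^ (-(2:ℝ)/9)) r.domain → r'.domain = {x | x 0 ^ 2 + x 1 ^ 2 < 4} → Set.EqOn r'.integrand (fun _ => (3:ℝ) ^ ((7:ℝ)/6) / 2) r'.domain → Literature.NumberTheory.Transcendental.KZ.Equivalent r r'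

/-- item stmt-KontsevichZagierPeriods-12071 · crux · rank 2 · open · by planner
why it might fail: certificate boundary terms C·f must vanish on the CLOSED faces t = 0,1 for exponents (2/9,5/18),(7/18,1/9), and the second x-derivative kernels must stay absolutely integrable on the band up to x = 1 where the margin is exactly c−a−b = 1/9 resp. 1/18; one bad corner breaks the chain.
sources: BostanLairezSalvy2013, Lairez2015, AomotoKita2011, Vidunas2009, KontsevichZagier2001
[crux] for every real algebraic x ∈ [0,1] the two sides of (G3) at a = 1/6 in period form — A(x) on
(0,1)² with integrand u^{-11/18}(1−u)^{-8/9}·t^{-7/9}(1−t)^{-13/18}(1−xt)^{-1/6} (=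
B(7/18,1/9)·B(2/9,5/18)·2F1(1/6,2/9;1/2;x)) and B(x) with integrand
(1+x/3)^{-1/6}·u^{-7/9}(1−u)^{-13/18}·s^{-11/18}(1−s)^{-8/9}(1−φ(x)s)^{-1/18}, φ(x) = x(9−x)²/(3+x)³
— are STABLY KZ-equivalent: some finite product of Beta-shape representations multiplies [A(x)] −
[B(x)] into relations (card H1/H-b; mechanism: trivial anchor A(0) ~ B(0) by the coordinate swap,
one Newton–Leibniz move in x with the integrand family as primitive, telescoper certificates L_x f =
∂_t(C·f) for both kernels under L = x(1−x)∂² + (1/2 − (25/18)x)∂ − 1/27 turning ∂_x of the gauged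
Wronskian p·(E v′ − E′ v), p = x^{1/2}(1−x)^{8/9}, into total t-derivatives killed by KZStokesBox;
partner v = x^{1/2}·Euler family of 2F1(2/3,13/18;3/2;x) on (0,1), the exponent-1/9 solution at x =
1; spectators β₃ = B(5/6,2/3), β_v = B(5/18,5/6)). [deps: KZStokesBox] [difficulty: XL] -/
@[route_item "route-KontsevichZagierPeriods-TwoRouteTransport"]
def CubicTransportStable : Prop :=
  ∀ x : ℝ, IsAlgebraic ℚ x → x ∈ Set.Icc (0:ℝ) 1 → ∀ (r r' : Literature.NumberTheory.Transcendental.KZ.IntegralRep 2), r.domain = {y | ∀ i, y i ∈ Set.Ioo (0:ℝ) 1} → Set.EqOn r.integrand (fun y => (y 0) ^ (-(11:ℝ)/18) * (1 - y 0) ^ (-(8:ℝ)/9) * (y 1) ^ (-(7:ℝ)/9) * (1 - y 1) ^ (-(13:ℝ)/18) * (1 - x * y 1) ^ (-(1:ℝ)/6)) r.domain → r'.domain = {y | ∀ i, y i ∈ Set.Ioo (0:ℝ) 1} → Set.EqOn r'.integrand (fun y => (1 + x / 3) ^ (-(1:ℝ)/6) * (y 0) ^ (-(7:ℝ)/9)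 * (1 - y 0) ^ (-(13:ℝ)/18) * (y 1) ^ (-(11:ℝ)/18) * (1 - y 1) ^ (-(8:ℝ)/9) * (1 - (x * (9 - x) ^ 2 / (3 + x) ^ 3) * y 1) ^ (-(1:ℝ)/18)) r'.domain → ∃ l : List (Literature.NumberTheory.Transcendental.KZ.IntegralRep 1), (∀ β ∈ l, ∃ (C : ℝ) (p q : ℚ), C ≠ 0 ∧ (-1:ℚ) < p ∧ (-1:ℚ) < q ∧ β.domain = {y | y 0 ∈ Set.Ioo (0:ℝ) 1} ∧ Set.EqOn β.integrand (fun y => C * (y 0) ^ (p:ℝ) * (1 - y 0) ^ (q:ℝ)) β.domain) ∧ l.foldr (fun β c => Literature.NumberTheory.Transcendental.KZ.of β * c) (Literature.NumberTheory.Transcendental.KZ.of r - Literature.NumberTheory.Transcendental.KZ.of r') ∈ Literature.NumberTheory.Transcendental.KZ.relations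

/-- item stmt-KontsevichZagierPeriods-12072 · crux · rank 3 · open · by planner
why it might fail: kernel-conjecture strength: a proof needs structure of FormalRep ⧸ relations nobody has (the effective-vs-localised seam of PiCancellation 0540, HuberWustholz2022 App. A.4; no division by integers is a rule); a refutation (a Beta zero-divisor) refutes the summit itself.
sources: HuberWustholz2022, KontsevichZagier2001, AomotoKita2011, Ayoub2015
[crux] every 1-dimensional representation of Beta shape (domain (0,1), integrand C·u^p(1−u)^q with C
≠ 0 real and p, q > −1 rational) is a non-zero-divisor modulo the moves: [β]·c ∈ relations ⇒ c ∈
relations. It follows from the kernel form of the summit (eval is multiplicative, KZProductIdeal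
eval_mul', and B(p+1,q+1) ≠ 0), generalises the flavour of KZ.PiCancellation (stmt-0540,
KatzTower.PiCancellation), and is what upgrades stable transport to the clean identities (used
twice: in TransportGlue and in TriplicationGlue). [difficulty: open-problem] -/
@[route_item "route-KontsevichZagierPeriods-TwoRouteTransport"]
def BetaCancellation : Prop :=
  ∀ (β : Literature.NumberTheory.Transcendental.KZ.IntegralRep 1), (∃ (C : ℝ) (p q : ℚ), C ≠ 0 ∧ (-1:ℚ) < p ∧ (-1:ℚ) < q ∧ β.domain = {x | x 0 ∈ Set.Ioo (0:ℝ) 1} ∧ Set.EqOn β.integrand (fun x => C * (x 0) ^ (p:ℝ) * (1 - x 0) ^ (q:ℝ)) β.domain) → ∀ c : Literature.NumberTheory.Transcendental.KZ.FormalRep, Literature.NumberTheory.Transcendental.KZ.of β * c ∈ Literature.NumberTheory.Transcendental.KZ.relations → c ∈ Literature.NumberTheory.Transcendental.KZ.relations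

/-- item stmt-KontsevichZagierPeriods-12073 · crux · rank 4 · open · by planner
why it might fail: equivalent to 0312 modulo accessible duplication, so it inherits Neg's bet 0311; transport reaches it only up to Beta spectators (needs BetaCancellation) and must END on the singular fibre x = 1, where Abel's limit is not a move.
sources: Vidunas2009, Goursat1881, AndrewsAskeyRoy1999, Deligne1982HodgeCycles
[crux] the x = 1 specialisation of (G3) at a = 1/6 in Euler-period form, as a KZ-equivalence of two
2-dimensional representations on (0,1)²: integrand s^{-11/18}(1−s)^{-8/9}·t^{-7/9}(1−t)^{-8/9}
(value B(7/18,1/9)·B(2/9,1/9)) versus (3/4)^{1/6}·s^{-7/9}(1−s)^{-13/18}·t^{-11/18}(1−t)^{-17/18}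
(value (3/4)^{1/6}·B(2/9,5/18)·B(7/18,1/18)); both 143.43224118…; in Γ-form Γ(1/9)²Γ(4/9) =
(3/4)^{1/6}Γ(1/3)Γ(5/18)Γ(1/18) (card H3 made explicit; the bare endpoint bet, reachable by other
engines too). [deps: CubicTransportStable, BetaCancellation] [difficulty: open-problem] -/
@[route_item "route-KontsevichZagierPeriods-TwoRouteTransport", crux]
def CubicEndpoint : Prop :=
  ∀ (r r' : Literature.NumberTheory.Transcendental.KZ.IntegralRep 2), r.domain = {x | ∀ i, x i ∈ Set.Ioo (0:ℝ) 1} → Set.EqOn r.integrand (fun x => (x 0) ^ (-(11:ℝ)/18) * (1 - x 0) ^ (-(8:ℝ)/9) * (x 1) ^ (-(7:ℝ)/9) * (1 - x 1) ^ (-(8:ℝ)/9)) r.domain → r'.domain = {x | ∀ i, x i ∈ Set.Ioo (0:ℝ) 1} → Set.EqOn r'.integrand (fun x => ((3:ℝ)/4) ^ ((1:ℝ)/6) * (x 0) ^ (-(7:ℝ)/9) * (1 - x 0) ^ (-(13:ℝ)/18) * (x 1) ^ (-(11:ℝ)/18) * (1 - x 1) ^ (-(17:ℝ)/18)) r'.domain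 → Literature.NumberTheory.Transcendental.KZ.Equivalent r r'

/-- item stmt-KontsevichZagierPeriods-14633 · crux · rank 5 · open · by planner
why it might fail: GPC-strength: ker(eval) on FormalRep⧸relations is at most the ℚ̄-line through the endpoint class — Conjecture 1 for all rational pairs up to one direction (with CubicEndpoint = summit; odd-zeta/2πi-log independence follow); only the halving collapse is excluded, a product collapse would misstate it.
sources: KontsevichZagier2001, Ayoub2015, HuberMullerStach2017, HuberWustholz2022
[crux] relative completeness of the KZ calculus modulo the ℚ̄_ℝ-LINE through the CUBIC-ENDPOINT
class (rev 4; rev 3 = the refuter's repair C″ of the rev-2 wording, whose cyclic modulus on the 0312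
difference was kernel-checked equivalent to the summit — the modulus must be SCALE-CLOSED; rev 4
re-points it from the 0312 pair to the cubic-endpoint pair so that the deciding theorem assumes
cruxes only, human ruling 2026-08-16). Universal-property form: for every additive subgroup K of
formal representations with relations ≤ K, K stable under every scaling endomorphism `KZ.scale a`
([σ, f] ↦ [σ, a·f], a real algebraic), and K containing [ρ] − [ρ'] for all representations ρ, ρ' of
the two CubicEndpoint shapes (x = 1 fibre of Goursat's cubic:
s^{-11/18}(1−s)^{-8/9}·t^{-7/9}(1−t)^{-8/9} versus
(3/4)^{1/6}·s^{-7/9}(1−s)^{-13/18}·t^{-11/18}(1−t)^{-17/18} on (0,1)², both of value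
143.432241180858…), any two RATIONAL representations r, r' (KZ §1.1 shape) with equal value have [r]
− [r'] ∈ K. In V = FormalRep ⧸ relations (a ℚ̄_ℝ-vector space via KZ.scale: divisible, torsion-free)
this reads ker(eval) ⊆ ℚ̄_ℝ·[d_E], d_E = the endpoint difference class: Conjecture 1 up to the
single direction [d_ -/
@[route_item "route-KontsevichZagierPeriods-TwoRouteTransport", crux]
def CompleteModCubicEndpoint : Prop :=
  ∀ K : AddSubgroup Literature.NumberTheory.Transcendental.KZ.FormalRep, Literature.NumberTheory.Transcendental.KZ.relations ≤ K → (∀ (a : ℝ) (ha : IsAlgebraic ℚ a) (c : Literature.NumberTheory.Transcendental.KZ.FormalRep), c ∈ K → Literature.NumberTheory.Transcendental.KZ.scale a ha c ∈ K) → (∀ (ρ ρ' : Literature.NumberTheory.Transcendental.KZ.IntegralRep 2), ρ.domain = {x | ∀ i, x i ∈ Set.Ioo (0:ℝ) 1} → Set.EqOn ρ.integrand (fun x => (x 0) ^ (-(11:ℝ)/18) * (1 - x 0) ^ (-(8:ℝ)/9) * (x 1) ^ (-(7:ℝ)/9) * (1 - x 1) ^ (-(8:ℝ)/9)) ρ.domain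 → ρ'.domain = {x | ∀ i, x i ∈ Set.Ioo (0:ℝ) 1} → Set.EqOn ρ'.integrand (fun x => ((3:ℝ)/4) ^ ((1:ℝ)/6) * (x 0) ^ (-(7:ℝ)/9) * (1 - x 0) ^ (-(13:ℝ)/18) * (x 1) ^ (-(11:ℝ)/18) * (1 - x 1) ^ (-(17:ℝ)/18)) ρ'.domain → Literature.NumberTheory.Transcendental.KZ.of ρ - Literature.NumberTheory.Transcendental.KZ.of ρ' ∈ K) → ∀ ⦃n m : ℕ⦄ (r : Literature.NumberTheory.Transcendental.KZ.IntegralRep n) (r' : Literature.NumberTheory.Transcendental.KZ.IntegralRep m), r.IsRational → r'.IsRational → r.value = r'.value → Literature.NumberTheory.Transcendental.KZ.of r - Literature.NumberTheory.Transcendental.KZ.of r' ∈ K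

/-- item stmt-KontsevichZagierPeriods-12074 · support · rank 9 · closed · proved by Summit.KontsevichZagierPeriods.TwoRouteTransport.transportGlue_proof @ 5c628d285a1d (prover) · by planner
sources: KontsevichZagier2001
[support] glue of the foreseen split of CubicEndpoint: CubicTransportStable → BetaCancellation →
CubicEndpoint (instantiate x = 1: φ(1) = 1, (1+1/3)^{-1/6} = (3/4)^{1/6}, (1−t)^{-13/18}(1−t)^{-1/6}
= (1−t)^{-8/9} and (1−t)^{-8/9}(1−t)^{-1/18} = (1−t)^{-17/18} pointwise on (0,1), so the Set.EqOn
hypotheses transfer; then peel the Beta spectators off the foldr by induction on the list with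
BetaCancellation). [difficulty: provable-now] -/
@[route_item "route-KontsevichZagierPeriods-TwoRouteTransport"]
def TransportGlue : Prop :=
  CubicTransportStable → BetaCancellation → CubicEndpoint

/-- item stmt-KontsevichZagierPeriods-12075 · support · rank 9 · closed · proved by Summit.KontsevichZagierPeriods.TwoRouteTransport.triplicationGlue_proof @ 1c641feac763 (prover) · by planner
sources: KontsevichZagier2001, AndrewsAskeyRoy1999
[support] Γ-bookkeeping inside the product calculus (KZProductIdeal, all PROVED: relations is a
two-sided ideal, products commute modulo relations, reindexing is a change of variables):
CubicEndpoint → BetaCancellation → DuplicationFamily → TriplicationAccessible (the DuplicationFamily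
hypothesis is written out verbatim in the Lean term so that the decl does not depend on rendering
order; it is the same Prop as item DuplicationFamily). Multiply the 0312 product T =
B(1/9,4/9)·B(5/9,7/9) by a Beta spectator X; regroup with Beta symmetry (u ↦ 1−u), Dirichlet
associativity B(x,y)B(x+y,z) ~ B(y,z)B(y+z,x) (both ~ the Dirichlet simplex by (u,v) ↦ (u,(1−u)v)),
translation (Newton–Leibniz with monomial primitive) and B(x,1) ~ 1/x; apply CubicEndpoint, then
DuplicationFamily at a = 1/18 and a = 5/18 (symbolically: endpoint × dup(1/18) × dup(5/18) ⟺
Γ(1/9)Γ(4/9)Γ(7/9) = 2π·3^{1/6}Γ(1/3), re-derived this session); the Γ-content becomes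
2·3^{7/6}·B(1/2,1/2)·X; cancel X (BetaCancellation); [B(1/2,1/2)] ~ [unit disc, 1] (u = (1+v)/2,
KZ's own 2∫√(1−v²) = ∫1/√(1−v²) step, band |w| ≤ √(1−v²)) and the scaling (v,w) ↦ (2v,2w) give the
radius-2 disc with constant 3^{7/6}/2. [difficulty: L] -/
@[route_item "route-KontsevichZagierPeriods-TwoRouteTransport"]
def TriplicationGlue : Prop :=
  CubicEndpoint → BetaCancellation → (∀ a : ℚ, 0 < a → ∀ (r r' : Literature.NumberTheory.Transcendental.KZ.IntegralRep 1), r.domain = {x | x 0 ∈ Set.Ioo (0:ℝ) 1} → Set.EqOn r.integrand (fun x => (x 0 * (1 - x 0)) ^ ((a:ℝ) - 1)) r.domain → r'.domain = {x | x 0 ∈ Set.Ioo (0:ℝ) 1} → Set.EqOn r'.integrand (fun x => (2:ℝ) ^ (1 - 2 * (a:ℝ)) * (x 0) ^ (-(1:ℝ)/2) * (1 - x 0) ^ ((a:ℝ) - 1)) r'.domain → Literature.NumberTheory.Transcendental.KZ.Equivalent r r') → TriplicationAccessible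

/-- item stmt-KontsevichZagierPeriods-3015 · support · rank 9 · closed · proved by Summit.KontsevichZagierPeriods.GaussManinCertificates.KZStokesBox_proof @ b1634edc3df5 (prover) · by planner
sources: KontsevichZagier2001, Lairez2015
[support] KZStokes on an open box (real corners; ℚ-semialgebraicity is carried by r and by the
hypothesis on H) (one band over the base box: newtonLeibnizRel + two null faces by domain
additivity); unblocks LegendreModulusPropagation without the CAD fact. [difficulty: provable-now] -/
@[route_item "route-KontsevichZagierPeriods-TwoRouteTransport"]
def KZStokesBox : Prop :=
  ∀ (n : ℕ) (a b : Fin (n + 1) → ℝ) (r : Literature.NumberTheory.Transcendental.KZ.IntegralRep (n + 1)) (H : (Fin (n + 1) → ℝ) → ℝ), (∀ i, a i < b i) → r.domain = {z | ∀ i, z i ∈ Set.Ioo (a i) (b i)} → Literature.NumberTheory.Transcendental.IsSemialgebraicFunOn ℚ {z | ∀ i, z i ∈ Set.Icc (a i) (b i)} H → (∀ x : Fin n → ℝ, (∀ i, x i ∈ Set.Ioo (a (Fin.castSucc i)) (b (Fin.castSucc i))) → ContinuousOn (fun s : ℝ => H (Fin.snoc x s)) (Set.Icc (a (Fin.last n))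 (b (Fin.last n))) ∧ H (Fin.snoc x (a (Fin.last n))) = 0 ∧ H (Fin.snoc x (b (Fin.last n))) = 0 ∧ ∀ t ∈ Set.Ioo (a (Fin.last n)) (b (Fin.last n)), HasDerivAt (fun s : ℝ => H (Fin.snoc x s)) (r.integrand (Fin.snoc x t)) t) → Literature.NumberTheory.Transcendental.KZ.of r ∈ Literature.NumberTheory.Transcendental.KZ.relations

/-- `KZStokesBox` holds: proved by `Summit.KontsevichZagierPeriods.GaussManinCertificates.KZStokesBox_proof` @ b1634edc3df5. -/
theorem KZStokesBox_holds : KZStokesBox := _root_.Summit.KontsevichZagierPeriods.GaussManinCertificates.KZStokesBox_proof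

/-- item stmt-KontsevichZagierPeriods-3727 · support · rank 9 · closed · proved by Summit.KontsevichZagierPeriods.MellinCoarea.duplicationFamily_proof @ e561ebe3bd4b (prover) · by planner
sources: AndrewsAskeyRoy1999, KontsevichZagier2001
[support] Legendre duplication in Beta form for every rational a > 0: [(0,1), (u(1−u))^{a−1}] ~
[(0,1), 2^{1−2a}·u^{-1/2}(1−u)^{a−1}] (three moves: split at u = 1/2, u ↦ 1−u, t = 4u(1−u));
stmt-0118 is the instance a = 1/3; the Assembly uses a = 1/18 and a = 5/18. [difficulty:
provable-now] -/
@[route_item "route-KontsevichZagierPeriods-TwoRouteTransport"]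
def DuplicationFamily : Prop :=
  ∀ a : ℚ, 0 < a → ∀ (r r' : Literature.NumberTheory.Transcendental.KZ.IntegralRep 1), r.domain = {x | x 0 ∈ Set.Ioo (0:ℝ) 1} → Set.EqOn r.integrand (fun x => (x 0 * (1 - x 0)) ^ ((a:ℝ) - 1)) r.domain → r'.domain = {x | x 0 ∈ Set.Ioo (0:ℝ) 1} → Set.EqOn r'.integrand (fun x => (2:ℝ) ^ (1 - 2 * (a:ℝ)) * (x 0) ^ (-(1:ℝ)/2) * (1 - x 0) ^ ((a:ℝ) - 1)) r'.domain → Literature.NumberTheory.Transcendental.KZ.Equivalent r r'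

-- earlier Assembly (stmt-KontsevichZagierPeriods-12077, replaced 2026-08-16T02:59:53Z -> stmt-KontsevichZagierPeriods-14100): retired by None — CubicTransportStable → BetaCancellation → TransportGlue → DuplicationFamily → TriplicationGlue → TriplicationComplete → KontsevichZagierPeriods
-- earlier Assembly (stmt-KontsevichZagierPeriods-14100, replaced 2026-08-16T04:11:06Z -> stmt-KontsevichZagierPeriods-14634): retired by None — CubicTransportStable → BetaCancellation → TransportGlue → DuplicationFamily → TriplicationGlue → CompleteModTriplication → KontsevichZagierPeriods
/-- item stmt-KontsevichZagierPeriods-14634 · assembly · rank 1 · closed · proved by Summit.KontsevichZagierPeriods.TwoRouteTransport.assembly_proof @ df7cf94f0bcc (prover) · by planner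
sources: KontsevichZagier2001, AndrewsAskeyRoy1999
[assembly] the whole line in one Prop (rev 4): CubicTransportStable → BetaCancellation →
TransportGlue → CompleteModCubicEndpoint → the sub-problem statement (TransportGlue turns X1 ∧ X2
into CubicEndpoint; the deciding theorem `closes` is its crux-only core CubicEndpoint →
CompleteModCubicEndpoint → KontsevichZagierPeriods, two lines, kernel-checked; inhabited as
`assembly2_holds` in the planner's Sketch.lean). -/
@[route_item "route-KontsevichZagierPeriods-TwoRouteTransport"]
def Assembly : Prop :=
  CubicTransportStable → BetaCancellation → TransportGlue → CompleteModCubicEndpoint → KontsevichZagierPeriods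

-- records of items no longer active in this route (dropped / restated):
-- earlier CompleteModTriplication (stmt-KontsevichZagierPeriods-14101, replaced 2026-08-16T03:59:00Z -> stmt-KontsevichZagierPeriods-14582): retired by None — ∀ K : AddSubgroup Literature.NumberTheory.Transcendental.KZ.FormalRep, Literature.NumberTheory.Transcendental.KZ.relations ≤ K → (∀ (ρ ρ' : Literature.NumberTheory.Transcendental.KZ.IntegralRep 2), ρ.domain = {x | ∀ i, x i ∈ Set.Ioo (0:ℝ) 1} →
-- earlier CompleteModTriplication (stmt-KontsevichZagierPeriods-14582, replaced 2026-08-16T04:11:06Z -> stmt-KontsevichZagierPeriods-14633): retired by None — ∀ K : AddSubgroup Literature.NumberTheory.Transcendental.KZ.FormalRep, Literature.NumberTheory.Transcendental.KZ.relations ≤ K → (∀ (a : ℝ) (ha : IsAlgebraic ℚ a) (c : Literature.NumberTheory.Transcendental.KZ.FormalRep), c ∈ K → Literature.Nu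

/-! D-0027 §2.1 — DECIDING THEOREM (planner-authored via `route open/edit --closes-file`; by planner-rrefute-KontsevichZagierPeriods-TwoRou-c2c3b362-0 2026-08-16T04:11:06Z):
its hypotheses are this route's items and its conclusion the sub-problem Statement (glue_lint), and it elaborates with this file. -/

@[closes "route-KontsevichZagierPeriods-TwoRouteTransport"] theorem closes (h₄ : CubicEndpoint) (h₆ : CompleteModCubicEndpoint) : KontsevichZagierPeriods := by
  intro n m r r' hr hr' hv
  exact h₆ _ le_rfl (fun a ha c hc => Literature.NumberTheory.Transcendental.KZ.scale_mem_relations a ha hc) (fun ρ ρ' hd hi hd' hi' => h₄ ρ ρ' hd hi hd' hi') r r' hr hr' hv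

end Summit.KontsevichZagierPeriods.KontsevichZagierPeriods.Theses.TwoRouteTransport
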